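import Summits.BirchSwinnertonDyer.BirchSwinnertonDyer.Theorems.SylvesterTwoHeegnerIndexYinUpperRung
import HarnessLib

/-!
# Route `SylvesterTwoHeegnerIndex` (rung K7t): the HAND ITEMS 19229 `HeegnerIndexUpperAtTwoHSY` / 19230
# `HeegnerIndexLowerAtTwoHSY` BY NAME in Yin's point currency, and the rung leaf as ONE «exact index»
# residual — part III of `…YinLower` / `…YinUpperRung`

Cell `bsd-cm`, seat `bsd-cm-k7t-c2` (prover-bsd-cm-k7t-c2-g9-0; hand «find: 19229», D-0074). PARTITION
(D-0054): CornerF at `p = 2` (B14/O12) × 𝒞_HSY × `p = 2` — types-the-object-of (kernel,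
`--supports stmt-BirchSwinnertonDyer-19229`); closes no cell and no item; BSD is not claimed. Everything
here is PROVED: no definition, no named fact, no `sorry`. The residuals (low) / (up) are the DISPLAYED
HYPOTHESES of parts I–II (verbatim in the signatures); (exact) is their conjunction in one line:

* **(exact)** — granted `PublishedFactsTwoPlus`: at every display datum `(K ∋ ω, P₀, Y, u)` of every
  member there is `j` with `Y ∈ 2^j·B(K) + tors`, `Y ∉ 2^{j+1}·B(K) + tors` and `2j + 2δ = ord₂ #Ш(B)[2^∞]`
  (`2δ = 0 | −2` for `p ≡ 4 | 7 (9)`).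

THEOREMS (granted Yin's display `SylvesterTwoYin.YinHeightDisplay`, PREPRINT shape):
* `heegnerIndexUpperAtTwoHSY_of_yin_of_up` — the fact-free UPPER crux 19229 (this seat's hand item, aside)
  BY NAME from `PublishedFactsTwoPlus` + display + (up) (its facts-plus twin 19725 is literally
  `PublishedFactsTwoPlus → HeegnerIndexUpperAtTwoHSY`); `heegnerIndexLowerAtTwoHSY_of_yin_of_low` — the
  fact-free LOWER crux 19230 BY NAME from `PublishedFactsTwo` + display + (low). CONDITIONAL (displayed
  hypotheses; the gate records `proof.conditional`, credits nothing).
* **`cmAtTwo_iff_exact_of_yin`** — granted `PublishedFactsTwoPlus` and the display, the rung leaf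
  `X12.CMAtTwo` ⟺ (exact): `BSD(E_p, 2)` on the Sylvester family IS «the `2`-divisibility index of Yin's
  point `Z_p` in `E_p(ℚ(√−3))/tors ≅ ℤ[ω]` equals `ord₂ #Ш(E_p)[2^∞]/2 − δ`», one integer per `p`
  (memo two Thm B (iii), single curve); proved WITHOUT the route's deciding theorem (per member:
  `BSDp ⟺ MissingPPartAt` in analytic rank one, Miller + GZK, and part I's
  `missingPPartAt_two_iff_exists_exactIndex`).

HONEST READING. Reformulations of open statements; nothing decided for any `p`. (exact) on
{`Ш(E_p)[2] = 0`} reads: `Z_p` is `2`-primitive (p ≡ 4 (9)) / exactly once `2`-divisible (p ≡ 7 (9)) —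
the cell's certified rows (k7t-c3 CERT, two N5′/N6) are its per-member instances; class-wide it is B14 = O12.

## References
* H. Yin, arXiv:2607.01744 (2026), Thm. 1.1, (3.5.3), p. 12 (PREPRINT).
* Y. Hu, J. Shu, H. Yin, Trans. AMS 372 (2019), Thm. 1.3/1.4, (bsd) p. 12; R. L. Miller, LMS J. Comput. Math.
  14 (2011), Def. 1.1; V. A. Kolyvagin (1990), Thm. A; A. Burungale, M. Flach, Camb. J. Math. 12 (2024), Cor. 2.
* MEMO bsd-cm-two v2.11 §15.2 Thm B; parents: this seat's p511845 / p512832 / p513215.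
-/

set_option autoImplicit false
-- the Summit-side namespace `Summit.BirchSwinnertonDyer.BirchSwinnertonDyer.…` (summit = problem) is mandated by D-0017
set_option linter.dupNamespace false

noncomputable section

open scoped Classical

open WeierstrassCurve WeierstrassCurve.Affine WeierstrassCurve.Affine.Point
  Summit.BirchSwinnertonDyer.BirchSwinnertonDyer.Theorems.SylvesterTwoCMNormForm
  Summit.BirchSwinnertonDyer.BirchSwinnertonDyer.Theorems.SylvesterTwoNonneg
  Summit.BirchSwinnertonDyer.BirchSwinnertonDyer.Theorems.SylvesterTwoThmCAssembly
  Literature.NumberTheory.EllipticCurves Literature.NumberTheory.EllipticCurves.HuShuYin2019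
  Literature.NumberTheory.EllipticCurves.Rank1Residual.Typed

namespace Summit.BirchSwinnertonDyer.BirchSwinnertonDyer.Theorems.SylvesterTwoYinLower

/-! ## §4 The hand items 19229 / 19230 BY NAME, and the leaf as ONE «exact index» residual -/

/-- **The fact-free UPPER crux 19229 `HeegnerIndexUpperAtTwoHSY` (this seat's hand item, aside) BY NAME ⟸
`PublishedFactsTwoPlus` + Yin's display + (up).** The facts-plus twin 19725 is literally
`PublishedFactsTwoPlus → HeegnerIndexUpperAtTwoHSY` (the route file spells the antecedent out), so §2's
`upperOfFactsPlus_of_yin_of_up` applied to the facts IS the hand item. CONDITIONAL (displayed hypotheses;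
credits nothing); (up) is open. [cite: Kolyvagin1990, Thm. A] [cite: Miller2011LMS, §1 and Def. 1.1] -/
theorem heegnerIndexUpperAtTwoHSY_of_yin_of_up
    (hFP : Theses.SylvesterTwoHeegnerIndex.PublishedFactsTwoPlus) (hY : SylvesterTwoYin.YinHeightDisplay)
    (hup : Theses.SylvesterTwoHeegnerIndex.PublishedFactsTwoPlus →
      ∀ (p : ℕ), p.Prime → (p % 9 = 4 ∨ p % 9 = 7) → (¬ ∃ x : ZMod p, x ^ 3 = 3) →
      ∀ (B : WeierstrassCurve ℚ) [B.IsElliptic] [B.IsGloballyMinimal],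
        (∃ C : VariableChange ℚ, C • B = cubeSumCurve (p : ℚ)) → ∀ (qB : ℚ), shaAn B = (qB : ℂ) →
      ∀ (K : Type) [Field K] [NumberField K] (ω : K), ω ^ 2 + ω + 1 = 0 → Module.finrank ℚ K = 2 →
      ∀ (P₀ : B.toAffine.Point), ¬ IsOfFinAddOrder (QuadraticDescent.incl K B P₀) →
        (∀ Q : B.toAffine.Point, ∃ m : ℤ,
          IsOfFinAddOrder (QuadraticDescent.incl K B Q - m • QuadraticDescent.incl K B P₀)) →
      ∀ (Y : (B.baseChange K).toAffine.Point) (u : ℚ), u ≠ 0 → padicValRat 2 u = 0 →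
        ((u * qB : ℚ) : ℝ) * canonicalHeight (QuadraticDescent.incl K B P₀) =
          (2 : ℝ) ^ (if p % 9 = 4 then (0 : ℤ) else -2) * canonicalHeight Y →
      ∃ j : ℕ, (∃ Y' T' : (B.baseChange K).toAffine.Point,
          IsOfFinAddOrder T' ∧ Y = ((2 : ℤ) ^ j) • Y' + T') ∧
        (padicValNat 2 (Nat.card (AddCommGroup.primaryComponent B.sha 2)) : ℤ) ≤
          2 * (j : ℤ) + (if p % 9 = 4 then (0 : ℤ) else -2)) :
    Theses.SylvesterTwoHeegnerIndex.HeegnerIndexUpperAtTwoHSY :=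
  upperOfFactsPlus_of_yin_of_up hY hup hFP

/-- **The fact-free LOWER crux 19230 `HeegnerIndexLowerAtTwoHSY` (k7t-c3's hand item, aside) BY NAME ⟸
`PublishedFactsTwo` + Yin's display + (low)** (the twin 19477 is literally `PublishedFactsTwo →
HeegnerIndexLowerAtTwoHSY`; part I's `lowerOfFacts_of_yin_of_low` applied to the facts). CONDITIONAL;
(low) is open. [cite: Miller2011LMS, §1 and Def. 1.1] [cite: HuShuYin2019, Thm. 1.3 / 1.4, pp. 8, 12] -/
theorem heegnerIndexLowerAtTwoHSY_of_yin_of_low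
    (hF : Theses.SylvesterTwoHeegnerIndex.PublishedFactsTwo) (hY : SylvesterTwoYin.YinHeightDisplay)
    (hlow : Theses.SylvesterTwoHeegnerIndex.PublishedFactsTwo →
      ∀ (p : ℕ), p.Prime → (p % 9 = 4 ∨ p % 9 = 7) → (¬ ∃ x : ZMod p, x ^ 3 = 3) →
      ∀ (B : WeierstrassCurve ℚ) [B.IsElliptic] [B.IsGloballyMinimal],
        (∃ C : VariableChange ℚ, C • B = cubeSumCurve (p : ℚ)) → ∀ (qB : ℚ), shaAn B = (qB : ℂ) →
      ∀ (K : Type) [Field K] [NumberField K] (ω : K), ω ^ 2 + ω + 1 = 0 → Module.finrank ℚ K = 2 →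
      ∀ (P₀ : B.toAffine.Point), ¬ IsOfFinAddOrder (QuadraticDescent.incl K B P₀) →
        (∀ Q : B.toAffine.Point, ∃ m : ℤ,
          IsOfFinAddOrder (QuadraticDescent.incl K B Q - m • QuadraticDescent.incl K B P₀)) →
      ∀ (Y : (B.baseChange K).toAffine.Point) (u : ℚ), u ≠ 0 → padicValRat 2 u = 0 →
        ((u * qB : ℚ) : ℝ) * canonicalHeight (QuadraticDescent.incl K B P₀) =
          (2 : ℝ) ^ (if p % 9 = 4 then (0 : ℤ) else -2) * canonicalHeight Y →
      ∀ j : ℕ, (∃ Y' T' : (B.baseChange K).toAffine.Point,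
          IsOfFinAddOrder T' ∧ Y = ((2 : ℤ) ^ j) • Y' + T') →
        2 * (j : ℤ) + (if p % 9 = 4 then (0 : ℤ) else -2) ≤
          (padicValNat 2 (Nat.card (AddCommGroup.primaryComponent B.sha 2)) : ℤ)) :
    Theses.SylvesterTwoHeegnerIndex.HeegnerIndexLowerAtTwoHSY :=
  lowerOfFacts_of_yin_of_low hY hlow hF

/-- Monotonicity of `2`-power divisibility modulo torsion: `Y ∈ 2^j·B + tors` and `j' ≤ j` give
`Y ∈ 2^{j'}·B + tors`. [folklore] -/
theorem powDivisible_mono {A : Type*} [AddCommGroup A] {Y : A} {j j' : ℕ} (hj : j' ≤ j)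
    (h : ∃ Y' T' : A, IsOfFinAddOrder T' ∧ Y = ((2 : ℤ) ^ j) • Y' + T') :
    ∃ Y' T' : A, IsOfFinAddOrder T' ∧ Y = ((2 : ℤ) ^ j') • Y' + T' := by
  obtain ⟨Y', T', hT', rfl⟩ := h
  refine ⟨((2 : ℤ) ^ (j - j')) • Y', T', hT', ?_⟩
  rw [smul_smul, ← pow_add, Nat.add_sub_cancel' hj]

/-- **THE RUNG LEAF AS ONE «EXACT INDEX» STATEMENT.** Granted `PublishedFactsTwoPlus` and Yin's display:
`X12.CMAtTwo` (`BSD(E_p, 2)` on 𝒞_HSY) ⟺ (exact) «granted the facts, at every display datum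
`(K ∋ ω, P₀, Y, u)` of every member there is `j` with `Y ∈ 2^j·B(K) + tors`, `Y ∉ 2^{j+1}·B(K) + tors`
and `2j + 2δ = ord₂ #Ш(B)[2^∞]`» — the `2`-divisibility index of Yin's point is EXACTLY
`ord₂ #Ш(E_p)[2^∞]/2 − δ`. `→`: per member `BSDp B 2 ⟹ MissingPPartAt B 2` (Hu–Shu–Yin: `Ш(B)` finite)
and part I's `missingPPartAt_two_iff_exists_exactIndex`; `←`: the same iff backwards, then Miller's
`BSD(E,2)` from the missing `2`-part in analytic rank one (`Typed.bsdp_of_missingPPartAt` with GZK and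
`r_an(E_p) = 1` from the facts) — no use of the route's deciding theorem. An EQUIVALENT REFORMULATION;
nothing decided. [cite: Miller2011LMS, §1 and Def. 1.1] [cite: HuShuYin2019, Thm. 1.3 / 1.4, pp. 8, 12]
[cite: BurungaleFlach2024, Thm. 1.1 and Cor. 2] -/
theorem cmAtTwo_iff_exact_of_yin (hFP : Theses.SylvesterTwoHeegnerIndex.PublishedFactsTwoPlus)
    (hY : SylvesterTwoYin.YinHeightDisplay) :
    _root_.Summit.BirchSwinnertonDyer.Rank1Residual.X12.CMAtTwo ↔
      (Theses.SylvesterTwoHeegnerIndex.PublishedFactsTwoPlus →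
      ∀ (p : ℕ), p.Prime → (p % 9 = 4 ∨ p % 9 = 7) → (¬ ∃ x : ZMod p, x ^ 3 = 3) →
      ∀ (B : WeierstrassCurve ℚ) [B.IsElliptic] [B.IsGloballyMinimal],
        (∃ C : VariableChange ℚ, C • B = cubeSumCurve (p : ℚ)) → ∀ (qB : ℚ), shaAn B = (qB : ℂ) →
      ∀ (K : Type) [Field K] [NumberField K] (ω : K), ω ^ 2 + ω + 1 = 0 → Module.finrank ℚ K = 2 →
      ∀ (P₀ : B.toAffine.Point), ¬ IsOfFinAddOrder (QuadraticDescent.incl K B P₀) →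
        (∀ Q : B.toAffine.Point, ∃ m : ℤ,
          IsOfFinAddOrder (QuadraticDescent.incl K B Q - m • QuadraticDescent.incl K B P₀)) →
      ∀ (Y : (B.baseChange K).toAffine.Point) (u : ℚ), u ≠ 0 → padicValRat 2 u = 0 →
        ((u * qB : ℚ) : ℝ) * canonicalHeight (QuadraticDescent.incl K B P₀) =
          (2 : ℝ) ^ (if p % 9 = 4 then (0 : ℤ) else -2) * canonicalHeight Y →
      ∃ j : ℕ, (∃ Y' T' : (B.baseChange K).toAffine.Point,
          IsOfFinAddOrder T' ∧ Y = ((2 : ℤ) ^ j) • Y' + T') ∧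
        ¬ (∃ Y' T' : (B.baseChange K).toAffine.Point,
          IsOfFinAddOrder T' ∧ Y = ((2 : ℤ) ^ (j + 1)) • Y' + T') ∧
        2 * (j : ℤ) + (if p % 9 = 4 then (0 : ℤ) else -2) =
          (padicValNat 2 (Nat.card (AddCommGroup.primaryComponent B.sha 2)) : ℤ)) := by
  haveI : Fact (2 : ℕ).Prime := ⟨Nat.prime_two⟩
  have hFP' := hFP
  obtain ⟨hF, -⟩ := hFP'
  have hF' := hF
  obtain ⟨hHSY, -, -, -, -, -, -, hGZK, -⟩ := hF'
  constructor
  · intro hleaf _ p hp h9 h3 B _ _ hB qB hqB K _ _ ω hω h2K P₀ hP hgen Y u hu0 hu hid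
    obtain ⟨A, _, _, CA, hCA⟩ := SylvesterTwoLowerSplit.exists_partner hp
    obtain ⟨-, -, hfinB, -⟩ := hHSY p hp h9 h3 A B hB ⟨CA, hCA⟩
    haveI : Finite B.sha := hfinB
    have hM : MissingPPartAt B 2 := missingPPartAt_of_bsdp B 2 (hleaf p hp h9 h3 B hB)
    obtain ⟨qB', hqB', hq0', hrank, -⟩ := hY p hp h9 B hB K ω hω h2K
    have e : qB' = qB := by exact_mod_cast hqB'.symm.trans hqB
    subst e
    have hp2 : p ≠ 2 := SylvesterTwoLower.ne_two_of_mod_nine h9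
    obtain ⟨j, hdiv, hndiv, hj⟩ := (missingPPartAt_two_iff_exists_exactIndex hω h2K hp hp2 B hB hqB
      hq0' hrank P₀ hP hgen Y hu0 hu (SylvesterTwoYin.even_displayExponent p) hid).mp hM
    refine ⟨j, hdiv, hndiv, ?_⟩
    rwa [padicValNat_shaOrder_eq_primaryComponent hHSY hp h9 h3 B hB] at hj
  · intro hex p hp h9 h3 B _ _ hB
    obtain ⟨A, _, _, CA, hCA⟩ := SylvesterTwoLowerSplit.exists_partner hp
    obtain ⟨-, hran, hfinB, -⟩ := hHSY p hp h9 h3 A B hB ⟨CA, hCA⟩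
    haveI : Finite B.sha := hfinB
    obtain ⟨ω, hω⟩ := exists_omega_cyclotomicField_three
    have h2K := finrank_cyclotomicField_three
    obtain ⟨qB, hqB, hq0, hrank, P, Y, u, hu0, hu, hP, hgen, hid⟩ :=
      hY p hp h9 B hB (CyclotomicField 3 ℚ) ω hω h2K
    have hp2 : p ≠ 2 := SylvesterTwoLower.ne_two_of_mod_nine h9
    obtain ⟨j, hdiv, hndiv, hj⟩ := hex hFP p hp h9 h3 B hB qB hqB (CyclotomicField 3 ℚ) ω hω h2K P hP
      hgen Y u hu0 hu hid
    have hM : MissingPPartAt B 2 :=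
      (missingPPartAt_two_iff_exists_exactIndex hω h2K hp hp2 B hB hqB hq0 hrank P hP hgen Y hu0 hu
        (SylvesterTwoYin.even_displayExponent p) hid).mpr
        ⟨j, hdiv, hndiv, by rw [padicValNat_shaOrder_eq_primaryComponent hHSY hp h9 h3 B hB]; exact hj⟩
    exact bsdp_of_missingPPartAt B 2 hGZK (by rw [hran]) hM

end Summit.BirchSwinnertonDyer.BirchSwinnertonDyer.Theorems.SylvesterTwoYinLower

end
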